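import Summits.BirchSwinnertonDyer.BirchSwinnertonDyer.Theorems.CMKolyvaginAtInertTwoSilentSupplyOfPrimeTwistSupply
import HarnessLib

/-!
# Route `CMKolyvaginAtInertTwo` (leaf `WAllCornerFTwo`, habitat H₂): THE END STATE OF THE LINE IN ONE THEOREM —
# `BSD₂` on H₂ ⟸ Kolyvagin's conjecture at the inert prime `2` on ONE-BIT Heegner fields + prime-twist non-vanishing in the class
# `p ≡ −1 (mod 4N_E)` + six prints

Seat `bsd-line-cmk2-p1` g22 (cell `bsd-print-cf2`), `--supports stmt-BirchSwinnertonDyer-28663` (helper; closes nothing by name).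
THEOREMS ONLY (no definition, no named fact, no `sorry`).  BSD is NOT proved by this: the two research hypotheses are displayed, not proved.

After the pen's rev 19–22 (R1′ restatement; crux HL′ 28663; derivations 28664/28667 closed by this seat) the deciding theorem `closes` of the
route consumes, besides prints and the declared residual 22838, exactly TWO open statements: Kolyvagin's conjecture at `2`
(`CMKolyvaginConjectureAtInertTwo`, 24648 = R0 28176 ∧ R1 28177) and the silent Heegner twin supply HL′.  This file records the sharper
end state reached by g21/g22 in ONE kernel theorem on the habitat:

* **`bsdp_two_onHabitat_of_oneBitKolyvaginConjecture_of_primeTwistSupply_of_printedInputs`** — hypotheses: the five BSD-side prints;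
  Gross 1991 Prop. 3.7 (2) for every `(W, K)`; (KC¹) Kolyvagin's conjecture at inert `2` RESTRICTED TO ONE-BIT HEEGNER FIELDS (the body of the
  pen's pending `CMKolyvaginConjectureAtInertTwoOneBit`, `Cruxes/CMExactDescentAtTwo/TURNKEY_route_edit_24648_onebit.lean`: 24648's text with
  «`Σ ≤ 1 →`» after the Heegner hypothesis); (HL‴) the universal-frame prime-twist supply (the body of the pen's
  `PrimeTwistSupplyAtMinusOneModFourN`: for `E ∈ H₂` some prime `p` with `4N_E ∣ p + 1` and `L(E^{(−p)},1) ≠ 0`).  Conclusion: `BSDp W 2` for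
  every `W ∈ H₂` (globally minimal, CM, `2` inert in the CM field, `ρ̄_{E,2}` onto, `r_an = 1`, odd Tamagawa product) with an optimal
  parametrisation of odd Manin constant.  Proof: HL‴ ⟹ the HL′ field `K = ℚ(√−p)` (`exists_silentHeegnerField_of_prime_twist`, p763965);
  frame and `y_K` of infinite order as in `CMSupply` (Gross–Zagier); (KC¹) at `(W, K)` gives the primitive class; the certificate-level one-bit
  class theorem (`bsdp_two_of_exists_certificate_of_sum_defect_le_one_of_printedInputs`, p762853) concludes.
* `bsdp_two_onHabitat_of_kolyvaginConjecture_of_primeTwistSupply_of_printedInputs` — the same from the route decl 24648 (∀ `K`) by name.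

So, modulo print, the open content of the leaf's habitat branch is: (KC¹) — Kolyvagin's `m_∞ = 0` at `p = 2` on H₂ over one-bit Heegner
fields (no printed `p = 2` analogue of W. Zhang 2014) — and (HL‴) — non-vanishing of `L(E^{(−p)},1)` for one prime `p ≡ −1 (mod 4N_E)`
(Ono–Skinner / first-moment territory).  BSD is NOT proved by this; no summit statement and no item is closed by this file.

References: [WZhang2014] Thm. 1.1; [Kolyvagin1991MathAnn] Thm. 2.2; [McCallumLMS1991] §5 Thm. 5.4; [GrossLMS1991] §2, §11, Prop. 3.7 (2);
[GrossZagier1986] I.6.3, V.§2; [OnoSkinner1998] Cor. 2 (shape of HL‴); [Milne1972ArithmeticAV] Thm. 1; [BurungaleFlach2024] Thm. 1.1, Cor. 2.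
-/

set_option autoImplicit false
-- the Theorems namespace of this sub repeats the summit name by design (D-0017 nested layout)
set_option linter.dupNamespace false

noncomputable section

open scoped Classical

open WeierstrassCurve NumberField Literature.NumberTheory.EllipticCurves
  Literature.NumberTheory.EllipticCurves.ModularForms
  Literature.NumberTheory.EllipticCurves.Rank1Residual
open Literature.NumberTheory.EllipticCurves.GrossLMS1991 (prop37_2_reductionCongruence_inert)
open Summit.BirchSwinnertonDyer.BirchSwinnertonDyer.Theses.CMKolyvaginAtInertTwo (CMKolyvaginConjectureAtInertTwo)

namespace Summit.BirchSwinnertonDyer.BirchSwinnertonDyer.Theorems.KolyvaginLowerTwo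

/-- **THE END STATE: `BSD₂` ON H₂ FROM (KC¹) + (HL‴) + PRINTS.**  For every `W ∈ H₂` with an optimal odd-Manin parametrisation: the five
BSD-side prints, Gross 3.7 (2) for every `(W, K)`, Kolyvagin's conjecture at inert `2` on ONE-BIT Heegner fields (body of the pen's
`CMKolyvaginConjectureAtInertTwoOneBit`) and the universal-frame prime-twist supply (body of `PrimeTwistSupplyAtMinusOneModFourN`) imply
`BSDp W 2`.  BSD is NOT proved by this. [cite: WZhang2014, Thm. 1.1] [cite: GrossLMS1991, §11 and Prop. 3.7 (2)] [cite: GrossZagier1986, I.6.3]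
[cite: BurungaleFlach2024, Thm. 1.1 and Cor. 2] [cite: OnoSkinner1998, Cor. 2 (shape of the supply; nothing asserted)] -/
theorem bsdp_two_onHabitat_of_oneBitKolyvaginConjecture_of_primeTwistSupply_of_printedInputs
    (hGZ : ∀ (N : ℕ) [NeZero N] (W : WeierstrassCurve ℚ) (K : Type) [Field K] [NumberField K], gross_zagier N W K)
    (hGZK : rank_eq_analyticRank_of_analyticRank_le_one) (hnf : exists_isNewformOf)
    (hMilneC : Milne1972.bsdQuotient_baseChange_quadratic_anyModel) (hBF : bsdTriple_of_hasCM_of_L_one_ne_zero)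
    (h37 : ∀ (W : WeierstrassCurve ℚ) [W.IsGloballyMinimal] [NeZero (W.conductorNorm ℤ)] (K : Type) [Field K] [NumberField K],
      prop37_2_reductionCongruence_inert (W.conductorNorm ℤ) W K)
    (hKC1 : ∀ (W : WeierstrassCurve ℚ) [W.IsElliptic] [W.IsGloballyMinimal] [NeZero (W.conductorNorm ℤ)],
      W.HasCM → Rank1Residual.CMInert W 2 → W.HasSurjectiveModNGaloisRep (2 : ℤ) → W.analyticRank = 1 → Odd W.tamagawaProduct →
      ∀ (K : Type) [Field K] [NumberField K], IsImaginaryQuadratic K → Odd (NumberField.discr K) → NumberField.discr K ≠ -3 →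
      SatisfiesHeegnerHypothesis (W.conductorNorm ℤ) K →
      (∑ q ∈ (NumberField.discr K).natAbs.primeFactors,
        ((if jacobiSym W.Δ.num q = -1 then 1 else 0) + (if jacobiSym W.Δ.num q = 1 ∧ Even (W.frobeniusTrace q) then 2 else 0)) ≤ 1) →
      ∀ (Dt : ModularParametrizationData W (W.conductorNorm ℤ)),
      (∀ z ∈ Dt.L.lattice, ∃ w ∈ periodLattice Dt.f, z = (Dt.c : ℂ) * w) → Odd Dt.c →
      ∀ (β : ℤ) (ι : K →+* ℂ) (d₁ : KolyvaginHeegnerData Dt β ι 1), ¬ IsOfFinAddOrder d₁.derivedPoint →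
      ∃ (n : ℕ) (d : KolyvaginHeegnerData Dt β ι n), Squarefree n ∧
        (∀ ℓ ∈ n.primeFactors, (Zhang2014.IsKolyvaginPrime (W.conductorNorm ℤ) W K 2 ℓ ∧ Rank1Residual.CMInert W ℓ)) ∧
        ¬ ∃ Q : (W.baseChange (ringClassField K ι n)).toAffine.Point, (2 : ℤ) • Q = d.derivedPoint)
    (hHL3 : ∀ (W : WeierstrassCurve ℚ) [W.IsElliptic] [W.IsGloballyMinimal] [NeZero (W.conductorNorm ℤ)],
      W.HasCM → Rank1Residual.CMInert W 2 → W.HasSurjectiveModNGaloisRep (2 : ℤ) → W.analyticRank = 1 →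
      ∃ p : ℕ, p.Prime ∧ (4 * W.conductorNorm ℤ : ℕ) ∣ p + 1 ∧ (W.quadraticTwist (-(p : ℚ))).entireLFunction 1 ≠ 0)
    (W : WeierstrassCurve ℚ) [W.IsElliptic] [W.IsGloballyMinimal] [NeZero (W.conductorNorm ℤ)]
    (hCM : W.HasCM) (hin : Rank1Residual.CMInert W 2) (hρ2 : W.HasSurjectiveModNGaloisRep 2) (hr : W.analyticRank = 1)
    (hT : Odd W.tamagawaProduct)
    (hfr : ∃ Dt : ModularParametrizationData W (W.conductorNorm ℤ),
      (∀ z ∈ Dt.L.lattice, ∃ w ∈ periodLattice Dt.f, z = (Dt.c : ℂ) * w) ∧ Odd Dt.c) :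
    BSDp W 2 := by
  obtain ⟨Dt, hopt, hc⟩ := hfr
  -- (HL‴) ⟹ the one-bit Heegner field with `L(E^{(d_K)}, 1) ≠ 0`
  obtain ⟨p, hp, hdvd, hLp⟩ := hHL3 W hCM hin hρ2 hr
  obtain ⟨K, _, _, hIQ, hodd, h3, hHe, hdef, hL⟩ := exists_silentHeegnerField_of_prime_twist W hCM hin hρ2 hp hdvd hLp
  -- the frame `(β, ι, d₁)` and `y_K` of infinite order (Gross–Zagier + modularity)
  obtain ⟨β, hβ⟩ := exists_dvd_sq_sub_discr_holds (W.conductorNorm ℤ) K hIQ hHe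
  let ι : K →+* ℂ := Classical.choice inferInstance
  obtain ⟨d₁⟩ := exists_kolyvaginHeegnerData_one
    (phi_heegnerTau_mem_singularModuliField_holds (W.conductorNorm ℤ) W K) hIQ Dt β ι hβ
  have hy : ¬ IsOfFinAddOrder d₁.derivedPoint :=
    CMSupply.not_isOfFinAddOrder_derivedPoint_one_of_rankOne hnf W K (hGZ _ W K) hIQ hHe hr hL d₁
  -- (KC¹) at the one-bit field supplies the primitive class
  have hcert := hKC1 W hCM hin hρ2 hr hT K hIQ hodd h3 hHe hdef Dt hopt hc β ι d₁ hy
  exact bsdp_two_of_exists_certificate_of_sum_defect_le_one_of_printedInputs hGZ hGZK hnf hMilneC hBF W hCM hin hρ2 hr hT K hIQ hodd h3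
    hHe hdef (h37 W K) Dt hopt hc β ι d₁ hy hcert

/-- **The same end state from the route decl 24648 (Kolyvagin's conjecture at inert `2`, ∀ `K`) BY NAME and (HL‴).**
BSD is NOT proved by this. [cite: WZhang2014, Thm. 1.1] [cite: GrossLMS1991, §11 and Prop. 3.7 (2)] [cite: BurungaleFlach2024, Thm. 1.1 and Cor. 2] -/
theorem bsdp_two_onHabitat_of_kolyvaginConjecture_of_primeTwistSupply_of_printedInputs
    (hGZ : ∀ (N : ℕ) [NeZero N] (W : WeierstrassCurve ℚ) (K : Type) [Field K] [NumberField K], gross_zagier N W K)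
    (hGZK : rank_eq_analyticRank_of_analyticRank_le_one) (hnf : exists_isNewformOf)
    (hMilneC : Milne1972.bsdQuotient_baseChange_quadratic_anyModel) (hBF : bsdTriple_of_hasCM_of_L_one_ne_zero)
    (h37 : ∀ (W : WeierstrassCurve ℚ) [W.IsGloballyMinimal] [NeZero (W.conductorNorm ℤ)] (K : Type) [Field K] [NumberField K],
      prop37_2_reductionCongruence_inert (W.conductorNorm ℤ) W K)
    (hKC : CMKolyvaginConjectureAtInertTwo)
    (hHL3 : ∀ (W : WeierstrassCurve ℚ) [W.IsElliptic] [W.IsGloballyMinimal] [NeZero (W.conductorNorm ℤ)],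
      W.HasCM → Rank1Residual.CMInert W 2 → W.HasSurjectiveModNGaloisRep (2 : ℤ) → W.analyticRank = 1 →
      ∃ p : ℕ, p.Prime ∧ (4 * W.conductorNorm ℤ : ℕ) ∣ p + 1 ∧ (W.quadraticTwist (-(p : ℚ))).entireLFunction 1 ≠ 0)
    (W : WeierstrassCurve ℚ) [W.IsElliptic] [W.IsGloballyMinimal] [NeZero (W.conductorNorm ℤ)]
    (hCM : W.HasCM) (hin : Rank1Residual.CMInert W 2) (hρ2 : W.HasSurjectiveModNGaloisRep 2) (hr : W.analyticRank = 1)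
    (hT : Odd W.tamagawaProduct)
    (hfr : ∃ Dt : ModularParametrizationData W (W.conductorNorm ℤ),
      (∀ z ∈ Dt.L.lattice, ∃ w ∈ periodLattice Dt.f, z = (Dt.c : ℂ) * w) ∧ Odd Dt.c) :
    BSDp W 2 :=
  bsdp_two_onHabitat_of_oneBitKolyvaginConjecture_of_primeTwistSupply_of_printedInputs hGZ hGZK hnf hMilneC hBF h37
    (fun W _ _ _ hCM hin hρ hr hT K _ _ hK hodd h3 hH _ Dt hDt hc β ι d₁ hy ↦
      hKC W hCM hin hρ hr hT K hK hodd h3 hH Dt hDt hc β ι d₁ hy)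
    hHL3 W hCM hin hρ2 hr hT hfr

end Summit.BirchSwinnertonDyer.BirchSwinnertonDyer.Theorems.KolyvaginLowerTwo

end
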